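import Mathlib
import Literature.RingTheory.CohomologyAnnihilator.SyzygyDescent
import HarnessLib

/-!
# STD ⇒ persistence: the Ω-closure of strict transforms of high syzygies is stably annihilated

Crux `HomologicalConductor.Persistence` (stmt-ResolutionOfSingularities-16484), chain W4.4b.
Candidate mechanism M-A′ (tri-2, TRIAGE.md FS-5 / `L/res-L1-w44b-tri-2/STDSig.lean`): the tree's
syzygy-descent criterion ([`SyzygyDescent.lean`], p170768) CLOSED UNDER TAKING SYZYGIES. "STD_{t,e}":
every `e`-th `C`-syzygy of a finitely generated `C`-module lies in the smallest class of
`C`-modules that contains the STRICT TRANSFORMS of `(t+1)`-th `B`-syzygies (modules generated over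
`C` by an injective `B`-semilinear image of a `(t+1)`-th syzygy of a finitely generated `B`-module)
and the finitely generated projectives and is closed under isomorphism, binary products, retracts
and first syzygies (torically 0 failures / 1663 vertex charts, where plain descent fails 128 times).

This file PROVES the composition lemma tri-2 typed with `sorry` as
`TriageSTD.algebraMap_mem_cohomologyAnnihilatorOfDegree_of_STD` ("stub_closure_gives_core"), in a
DEFINITION-FREE form: the Ω-closure is expressed by its universal property (membership in every
class with the six closure properties), so the statement needs no `inductive`; tri-2's inductive
`OmegaClosure` satisfies it by its recursor.

* `algebraMap_mem_cohomologyAnnihilatorOfDegree_of_omegaClosure` — along a birational `B → C`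
  (`C` torsion-free over `B`, every `s : C` has `b s = r` with `b ∈ B⁰`), noetherian `B`, `C`:
  if `c ∈ caᵗ⁺¹(B)` and STD_{t,e} holds, then `algebraMap B C c ∈ caᵉ⁺¹(C)`.

Proof: the class `Q = {Y | algebraMap c · Extⁱ_C(Y, –) = 0 for all i ≥ 1}` has the six closure
properties — strict transforms by the landed birational transfer
(`smul_ext_eq_zero_of_isSyzygy_of_isBirational`), projectives trivially, isomorphisms and retracts
by functoriality (`ext_smul_eq_zero_of_retract`), binary products by the biproduct decomposition of
`Ext`, first syzygies by dimension shifting (`ext_smul_eq_zero_of_isSyzygy`) — so it contains every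
`e`-th syzygy, and `mem_extAnnihilatorFrom_of_isSyzygy` shifts back to `caᵉ⁺¹(C)`.
`[OURS · L1 w44b]`; folklore homological algebra, not a statement of any manuscript.
-/

-- single-problem summit: the doubled namespace component is forced
set_option linter.dupNamespace false

noncomputable section

open CategoryTheory CategoryTheory.Abelian CategoryTheory.Limits
open scoped nonZeroDivisors

universe u

namespace Summit.ResolutionOfSingularities.ResolutionOfSingularities.Theorems.HomologicalConductor.PersistenceSTDCore

open Literature.RingTheory.CohomologyAnnihilator

variable {C : Type u} [CommRing C]

/-! ## The class of modules stably annihilated by `a` in all positive degrees, and its closure properties -/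

/-- Projectives are stably annihilated by everything: `Extⁱ(P, –) = 0` for `i ≥ 1`
(`a • 𝟙 P = 𝟙 ≫ (a • 𝟙)` factors through the projective `P`). [folklore] -/
theorem smul_ext_eq_zero_of_projective (a : C) (P : ModuleCat.{u} C) [Projective P]
    (N : ModuleCat.{u} C) {i : ℕ} (hi : 1 ≤ i) (e : Ext.{u} P N i) : a • e = 0 :=
  smul_ext_eq_zero_of_comp_eq_smul_id (𝟙 P) (a • 𝟙 P) (Category.id_comp _) hi e

/-- Stable annihilation passes along isomorphisms. [folklore] -/
theorem smul_ext_eq_zero_of_iso (a : C) {Y Y' : ModuleCat.{u} C} (f : Y ≅ Y')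
    (hY : ∀ (N : ModuleCat.{u} C) (i : ℕ), 1 ≤ i → ∀ e : Ext.{u} Y N i, a • e = 0)
    (N : ModuleCat.{u} C) {i : ℕ} (hi : 1 ≤ i) (e : Ext.{u} Y' N i) : a • e = 0 :=
  ext_smul_eq_zero_of_retract f.inv f.hom f.inv_hom_id a (hY N i hi) e

/-- Stable annihilation passes to binary products: `Extⁱ(Y₁ × Y₂, N)` embeds in
`Extⁱ(Y₁, N) × Extⁱ(Y₂, N)` via the two inclusions (`𝟙 = fst ≫ inl + snd ≫ inr`). [folklore] -/
theorem smul_ext_eq_zero_of_prod (a : C) {Y₁ Y₂ : ModuleCat.{u} C}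
    (h₁ : ∀ (N : ModuleCat.{u} C) (i : ℕ), 1 ≤ i → ∀ e : Ext.{u} Y₁ N i, a • e = 0)
    (h₂ : ∀ (N : ModuleCat.{u} C) (i : ℕ), 1 ≤ i → ∀ e : Ext.{u} Y₂ N i, a • e = 0)
    (N : ModuleCat.{u} C) {i : ℕ} (hi : 1 ≤ i) (e : Ext.{u} (ModuleCat.of C (Y₁ × Y₂)) N i) :
    a • e = 0 := by
  let fst : ModuleCat.of C (Y₁ × Y₂) ⟶ Y₁ := ModuleCat.ofHom (LinearMap.fst C Y₁ Y₂)
  let snd : ModuleCat.of C (Y₁ × Y₂) ⟶ Y₂ := ModuleCat.ofHom (LinearMap.snd C Y₁ Y₂)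
  let inl : Y₁ ⟶ ModuleCat.of C (Y₁ × Y₂) := ModuleCat.ofHom (LinearMap.inl C Y₁ Y₂)
  let inr : Y₂ ⟶ ModuleCat.of C (Y₁ × Y₂) := ModuleCat.ofHom (LinearMap.inr C Y₁ Y₂)
  have htot : fst ≫ inl + snd ≫ inr = 𝟙 (ModuleCat.of C (Y₁ × Y₂)) := by
    apply ModuleCat.hom_ext
    refine LinearMap.ext fun y => ?_
    rcases y with ⟨y₁, y₂⟩
    simp [fst, snd, inl, inr, ModuleCat.hom_add]
  have hdec : e = (Ext.mk₀ fst).comp ((Ext.mk₀ inl).comp e (zero_add i)) (zero_add i) +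
      (Ext.mk₀ snd).comp ((Ext.mk₀ inr).comp e (zero_add i)) (zero_add i) := by
    rw [Ext.mk₀_comp_mk₀_assoc, Ext.mk₀_comp_mk₀_assoc, ← Ext.add_comp, ← Ext.mk₀_add, htot,
      Ext.mk₀_id_comp]
  have hβ₁ : a • (Ext.mk₀ inl).comp e (zero_add i) = 0 := h₁ N i hi _
  have hβ₂ : a • (Ext.mk₀ inr).comp e (zero_add i) = 0 := h₂ N i hi _
  have hγ₁ : a • (Ext.mk₀ fst).comp ((Ext.mk₀ inl).comp e (zero_add i)) (zero_add i) = 0 := by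
    rw [← Ext.comp_smul, hβ₁, Ext.comp_zero]
  have hγ₂ : a • (Ext.mk₀ snd).comp ((Ext.mk₀ inr).comp e (zero_add i)) (zero_add i) = 0 := by
    rw [← Ext.comp_smul, hβ₂, Ext.comp_zero]
  rw [hdec, smul_add, hγ₁, hγ₂, add_zero]

/-- Stable annihilation passes to first syzygies (dimension shifting along `0 → K → P → Y → 0`
with `P` projective: `Extʲ(K, –) ↞ Extʲ⁺¹(Y, –)`). [folklore] -/
theorem smul_ext_eq_zero_of_isSyzygy_one (a : C) {Y K : ModuleCat.{u} C} (hK : IsSyzygy 1 Y K)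
    (hY : ∀ (N : ModuleCat.{u} C) (i : ℕ), 1 ≤ i → ∀ e : Ext.{u} Y N i, a • e = 0)
    (N : ModuleCat.{u} C) {i : ℕ} (hi : 1 ≤ i) (e : Ext.{u} K N i) : a • e = 0 :=
  ext_smul_eq_zero_of_isSyzygy 1 hK N i hi a (fun e' => hY N (i + 1) (by omega) e') e

variable {B : Type u} [CommRing B] [Algebra B C]

/-- **Strict transforms of high `B`-syzygies are stably annihilated by `caᵗ⁺¹(B)`** (the landed
birational transfer `smul_ext_eq_zero_of_isSyzygy_of_isBirational`, with the `B`-structure on `Y`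
restricted from `C` and the semilinear additive map `φ` promoted to a `B`-linear map). [folklore] -/
theorem smul_ext_eq_zero_of_strictTransform [IsNoetherianRing B] [Module.IsTorsionFree B C]
    (hbir : ∀ s : C, ∃ b : B, b ∈ B⁰ ∧ ∃ r : B, algebraMap B C b * s = algebraMap B C r)
    {t : ℕ} {c : B} (hc : c ∈ cohomologyAnnihilatorOfDegree B (t + 1)) {Y : ModuleCat.{u} C}
    (hY : ∃ (X Y₀ : ModuleCat.{u} B) (φ : Y₀ →+ Y), Module.Finite B X ∧ IsSyzygy (t + 1) X Y₀ ∧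
      (∀ (b : B) (y : Y₀), φ (b • y) = algebraMap B C b • φ y) ∧ Function.Injective φ ∧
      Submodule.span C (Set.range φ) = ⊤)
    (N : ModuleCat.{u} C) {i : ℕ} (hi : 1 ≤ i) (e : Ext.{u} Y N i) :
    algebraMap B C c • e = 0 := by
  obtain ⟨X, Y₀, φ, hX, hY₀, hφlin, hφinj, hspan⟩ := hY
  haveI := hX
  letI : Module B Y := Module.compHom Y (algebraMap B C)
  haveI : IsScalarTower B C Y := IsScalarTower.of_algebraMap_smul fun _ _ => rfl
  let φ' : Y₀ →ₗ[B] Y :=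
    { toFun := φ
      map_add' := φ.map_add
      map_smul' := fun b y => by rw [hφlin]; rfl }
  have hφ'inj : Function.Injective φ' := hφinj
  have hspan' : Submodule.span C (Set.range φ') = ⊤ := hspan
  exact smul_ext_eq_zero_of_isSyzygy_of_isBirational hc hY₀ hbir φ' hφ'inj hspan' N hi e

/-! ## STD ⇒ persistence (definition-free form of tri-2's `stub_closure_gives_core`) -/

/-- **STD_{t,e} transports `caᵗ⁺¹(B)` into `caᵉ⁺¹(C)`** (tri-2's
`algebraMap_mem_cohomologyAnnihilatorOfDegree_of_STD`, Ω-closure stated by its universal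
property). Let `B → C` be birational with `B`, `C` noetherian and `C` torsion-free over `B`, and
`c ∈ caᵗ⁺¹(B)`. Suppose every `e`-th syzygy `K` of every finitely generated `C`-module belongs to
every class `Q` of `C`-modules that (1) contains the strict transforms of `(t+1)`-th `B`-syzygies,
(2) contains the finitely generated projectives, and is closed under (3) isomorphism, (4) binary
products, (5) retracts and (6) first syzygies. Then `algebraMap B C c ∈ caᵉ⁺¹(C)`: the class of
modules `Y` with `algebraMap c · Ext^{≥1}_C(Y, –) = 0` is such a `Q`, and dimension shifting
(`mem_extAnnihilatorFrom_of_isSyzygy`) returns from the `e`-th syzygy to the module. [folklore] -/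
theorem algebraMap_mem_cohomologyAnnihilatorOfDegree_of_omegaClosure [IsNoetherianRing B]
    [IsNoetherianRing C] [Module.IsTorsionFree B C] {t e : ℕ}
    (hbir : ∀ s : C, ∃ b : B, b ∈ B⁰ ∧ ∃ r : B, algebraMap B C b * s = algebraMap B C r)
    {c : B} (hc : c ∈ cohomologyAnnihilatorOfDegree B (t + 1))
    (hSTD : ∀ (M K : ModuleCat.{u} C), Module.Finite C M → IsSyzygy e M K →
      ∀ Q : ModuleCat.{u} C → Prop,
        (∀ Y : ModuleCat.{u} C, (∃ (X Y₀ : ModuleCat.{u} B) (φ : Y₀ →+ Y), Module.Finite B X ∧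
            IsSyzygy (t + 1) X Y₀ ∧ (∀ (b : B) (y : Y₀), φ (b • y) = algebraMap B C b • φ y) ∧
            Function.Injective φ ∧ Submodule.span C (Set.range φ) = ⊤) → Q Y) →
        (∀ P : ModuleCat.{u} C, Module.Finite C P → Projective P → Q P) →
        (∀ Y Y' : ModuleCat.{u} C, Q Y → Nonempty (Y ≅ Y') → Q Y') →
        (∀ Y₁ Y₂ : ModuleCat.{u} C, Q Y₁ → Q Y₂ → Q (ModuleCat.of C (Y₁ × Y₂))) →
        (∀ (Y Y' : ModuleCat.{u} C) (i : Y' ⟶ Y) (r : Y ⟶ Y'), i ≫ r = 𝟙 Y' → Q Y → Q Y') →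
        (∀ Y K : ModuleCat.{u} C, Q Y → IsSyzygy 1 Y K → Q K) → Q K) :
    algebraMap B C c ∈ cohomologyAnnihilatorOfDegree C (e + 1) := by
  set a : C := algebraMap B C c with ha
  -- the class of modules stably annihilated by `a` in all positive degrees
  let Q : ModuleCat.{u} C → Prop := fun Y =>
    ∀ (N : ModuleCat.{u} C) (i : ℕ), 1 ≤ i → ∀ x : Ext.{u} Y N i, a • x = 0
  have hQ : ∀ (M K : ModuleCat.{u} C), Module.Finite C M → IsSyzygy e M K → Q K := by
    intro M K hM hK
    refine hSTD M K hM hK Q ?_ ?_ ?_ ?_ ?_ ?_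
    · intro Y hY N i hi x
      exact smul_ext_eq_zero_of_strictTransform hbir hc hY N hi x
    · intro P _ hP N i hi x
      haveI := hP
      exact smul_ext_eq_zero_of_projective a P N hi x
    · rintro Y Y' hY ⟨f⟩ N i hi x
      exact smul_ext_eq_zero_of_iso a f hY N hi x
    · intro Y₁ Y₂ hY₁ hY₂ N i hi x
      exact smul_ext_eq_zero_of_prod a hY₁ hY₂ N hi x
    · intro Y Y' ι r hιr hY N i hi x
      exact ext_smul_eq_zero_of_retract ι r hιr a (hY N i hi) x
    · intro Y K hY hK N i hi x
      exact smul_ext_eq_zero_of_isSyzygy_one a hK hY N hi x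
  -- shift back from the `e`-th syzygy to the module
  rw [mem_cohomologyAnnihilatorOfDegree_iff_forall_mem_extAnnihilatorFrom]
  intro M hM
  haveI := hM
  obtain ⟨K, -, hK⟩ := exists_isSyzygy M e
  have h1 : a ∈ extAnnihilatorFrom K 1 := by
    rw [mem_extAnnihilatorFrom_iff]
    intro i hi N _ x
    exact hQ M K hM hK N i hi x
  have h2 := mem_extAnnihilatorFrom_of_isSyzygy e hK h1
  rwa [Nat.add_comm] at h2

/-- The `ca` version: if `c ∈ ca(B)` and for every `t` with `c ∈ caᵗ⁺¹(B)` some STD_{t,e} holds,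
then `algebraMap B C c ∈ ca(C)`. [folklore] -/
theorem algebraMap_mem_cohomologyAnnihilator_of_omegaClosure [IsNoetherianRing B]
    [IsNoetherianRing C] [Module.IsTorsionFree B C]
    (hbir : ∀ s : C, ∃ b : B, b ∈ B⁰ ∧ ∃ r : B, algebraMap B C b * s = algebraMap B C r)
    {c : B} (hc : c ∈ cohomologyAnnihilator B)
    (hSTD : ∀ t : ℕ, c ∈ cohomologyAnnihilatorOfDegree B (t + 1) → ∃ e : ℕ,
      ∀ (M K : ModuleCat.{u} C), Module.Finite C M → IsSyzygy e M K →
      ∀ Q : ModuleCat.{u} C → Prop,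
        (∀ Y : ModuleCat.{u} C, (∃ (X Y₀ : ModuleCat.{u} B) (φ : Y₀ →+ Y), Module.Finite B X ∧
            IsSyzygy (t + 1) X Y₀ ∧ (∀ (b : B) (y : Y₀), φ (b • y) = algebraMap B C b • φ y) ∧
            Function.Injective φ ∧ Submodule.span C (Set.range φ) = ⊤) → Q Y) →
        (∀ P : ModuleCat.{u} C, Module.Finite C P → Projective P → Q P) →
        (∀ Y Y' : ModuleCat.{u} C, Q Y → Nonempty (Y ≅ Y') → Q Y') →
        (∀ Y₁ Y₂ : ModuleCat.{u} C, Q Y₁ → Q Y₂ → Q (ModuleCat.of C (Y₁ × Y₂))) →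
        (∀ (Y Y' : ModuleCat.{u} C) (i : Y' ⟶ Y) (r : Y ⟶ Y'), i ≫ r = 𝟙 Y' → Q Y → Q Y') →
        (∀ Y K : ModuleCat.{u} C, Q Y → IsSyzygy 1 Y K → Q K) → Q K) :
    algebraMap B C c ∈ cohomologyAnnihilator C := by
  obtain ⟨n, hn⟩ := mem_cohomologyAnnihilator_iff.mp hc
  have hn' : c ∈ cohomologyAnnihilatorOfDegree B (n + 1) :=
    cohomologyAnnihilatorOfDegree_mono (Nat.le_succ n) hn
  obtain ⟨e, he⟩ := hSTD n hn'
  exact cohomologyAnnihilatorOfDegree_le (e + 1)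
    (algebraMap_mem_cohomologyAnnihilatorOfDegree_of_omegaClosure hbir hn' he)

end Summit.ResolutionOfSingularities.ResolutionOfSingularities.Theorems.HomologicalConductor.PersistenceSTDCore

end
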